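import Summits.HodgeConjecture.HodgeConjecture.Theorems.F0P2pJacquetConstituentLemmas       -- ★ p828054 (file 1/4): `twist_trivial_twist_comp_proj_apply`
import Literature.NumberTheory.Automorphic.UnitaryGroupPrincipalSeriesExponents                -- ★ `conjInvChar`, `cmTorusCharPair`, `cmWeylTorusCharPair`
import Literature.NumberTheory.Automorphic.AdelicUnitaryGroupUnimodular                        -- ★ `continuous_modularCharacter`
import HarnessLib

/-!
# Crux `H413`, pay-down of the K1w letter — file 4a: torus sections of `U(σ, Φ₃)` and `i_P^G(χ) = 0` for a discontinuous `χ`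

Cell hodgecm-mathlib (D-0151), FLOOR 0, crux item H413 = stmt-HodgeConjecture-24833; K1 sub-line `Lines/F0_P2GR91NJacquetK1.lean`, letter ★
`Rogawski1990.cmPrincipalSeries_isConstituentOf_weylConj` (p826332).  The letter carries NO continuity binders on `χ₁, χ₂` while the Jacquet-filtration
letter N1 (★ `U3PrincipalSeriesJacquetFiltration`) does; this file supplies the two generic facts that close the gap (theorems only, no definition):
* §1 torus algebra for `U(σ, Φ₃)(R)` (any commutative topological ring `R` with a continuous involution `σ`): (it is commutative: ★
  `UnitaryGroup.torusU_mul_comm`); `w² = 1` on character pairs (`conjInvChar_conjInvChar`); and **the components of a continuous pair character `t ↦ χ₁(t₀₀)χ₂(det t)`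
  are continuous** (`continuous_components_of_continuous_torusCharPair`) — restriction along the continuous sections `α ↦ d(α, ᾱα⁻¹, ᾱ⁻¹)` and
  `β ↦ d(1, β, 1)` of ★ `torusU`; `continuous_coe_conjInvChar`;
* §2 for any parabolic triple `t = (P, M, N)`: **`i_P^G(χ) = 0` when `χ : M → ℂˣ` is discontinuous** (`subsingleton_smoothInd_of_not_continuous`): a
  non-zero smooth `f` with `f(g) ≠ 0` gives `f(g) = f(mg) = δ_P^{1/2}(m) χ(m) f(g)` for `m` near `1`, so `χ = δ_P^{-1/2}` near `1` — continuous by ★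
  `continuous_modularCharacter` — and a homomorphism continuous at `1` is continuous ([BernsteinZelevinsky1976, §2.21–2.23]).
HC_CM is proved only modulo the 2 remaining named inputs (hLiu418, h413) until rung 0 closes; nothing here proves HC_CM.

## References
* [Rogawski1990] §1.10 p. 9, §12.1 p. 171, §12.2 p. 173.  * [BernsteinZelevinsky1976] §2.21–2.23.  * [Casselman1995] §3.1.
-/

set_option autoImplicit false
-- the mandated namespace has the single-problem summit's repeated segment (`HodgeConjecture.HodgeConjecture`)
set_option linter.dupNamespace false

noncomputable section

open NumberField IsDedekindDomain MeasureTheory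
open scoped Matrix

open Literature.NumberTheory Literature.NumberTheory.Automorphic Literature.NumberTheory.Automorphic.UnitaryGroup

namespace Summit.HodgeConjecture.HodgeConjecture.Cruxes.H413.F0P2pTorusPairsAndVacuity

/-! ## §1 Torus algebra for `U(σ, Φ₃)(R)` -/

section Torus

variable {R : Type*} [CommRing R] (σ : R →+* R) {N : ℕ} (J : Matrix (Fin N) (Fin N) R)

/-- **`w² = 1` on character pairs**: `χ̄̄₁⁻¹⁻¹ = χ₁` for an involution `σ`. [cite: Rogawski1990, §12.2 p. 173] -/
theorem conjInvChar_conjInvChar (hσ : ∀ x : R, σ (σ x) = x) (χ₁ : Rˣ →* ℂˣ) :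
    conjInvChar σ (conjInvChar σ χ₁) = χ₁ := by
  ext x
  have hx : Units.map (σ : R →* R) (Units.map (σ : R →* R) x) = x := Units.ext (hσ x)
  rw [conjInvChar_apply, conjInvChar_apply, hx, inv_inv]

variable [TopologicalSpace R] [IsTopologicalRing R]

/-- **The components of a continuous pair character are continuous** (`U(σ, Φ₃)`, `σ` a continuous involution): if
`t ↦ χ₁(t₀₀) χ₂(det t)` is continuous on `T` then so are `χ₁` on `Rˣ` and `χ₂` on `E¹ = normOneUnits σ` — restrict along the continuous sections
`α ↦ d(α, ᾱα⁻¹, ᾱ⁻¹)` (on which the pair is `χ₁(α)`) and `β ↦ d(1, β, 1)` (on which it is `χ₂(β)`). [cite: Rogawski1990, §12.1 p. 171] -/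
theorem continuous_components_of_continuous_torusCharPair (hσc : Continuous σ) (hσ : ∀ x : R, σ (σ x) = x)
    (J₃ : Matrix (Fin 3) (Fin 3) R) (hJ : J₃ = (StdForm.antidiagonal 3).over R)
    (χ₁ : Rˣ →* ℂˣ) (χ₂ : ↥(normOneUnits σ) →* ℂˣ)
    (h : Continuous fun t : ↥(torusU σ J₃) => ((torusCharPair σ J₃ hJ 0 χ₁ χ₂ t : ℂˣ) : ℂ)) :
    Continuous (fun x : Rˣ => ((χ₁ x : ℂˣ) : ℂ)) ∧ Continuous (fun x : ↥(normOneUnits σ) => ((χ₂ x : ℂˣ) : ℂ)) := by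
  subst hJ
  have hσu : ∀ u : Rˣ, Units.map (σ : R →* R) (Units.map (σ : R →* R) u) = u := fun u => Units.ext (hσ u)
  -- §a the section `α ↦ d(α, ᾱα⁻¹, ᾱ⁻¹)`
  let d₁ : Rˣ → Fin 3 → Rˣ := fun α => ![α, Units.map (σ : R →* R) α * α⁻¹, (Units.map (σ : R →* R) α)⁻¹]
  have hσv : ∀ u : Rˣ, σ (u : R) = ((Units.map (σ : R →* R) u : Rˣ) : R) := fun u => rfl
  have hd₁ : ∀ α, glDiagonal 3 R (d₁ α) ∈ unitaryGroupOfForm σ ((StdForm.antidiagonal 3).over R) := by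
    intro α
    rw [glDiagonal_mem_unitaryGroupOfForm_antidiagonal_iff]
    intro i
    fin_cases i
    · show σ (((Units.map (σ : R →* R) α)⁻¹ : Rˣ) : R) * (α : R) = 1
      rw [hσv, map_inv, hσu, Units.inv_mul]
    · show σ ((Units.map (σ : R →* R) α * α⁻¹ : Rˣ) : R) * ((Units.map (σ : R →* R) α * α⁻¹ : Rˣ) : R) = 1
      rw [hσv, map_mul, map_inv, hσu, ← Units.val_mul, mul_assoc, inv_mul_cancel_left, mul_inv_cancel, Units.val_one]
    · show σ ((α : Rˣ) : R) * (((Units.map (σ : R →* R) α)⁻¹ : Rˣ) : R) = 1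
      rw [hσv, Units.mul_inv]
  let t₁ : Rˣ → ↥(torusU σ ((StdForm.antidiagonal 3).over R)) := fun α => ⟨⟨glDiagonal 3 R (d₁ α), hd₁ α⟩, ⟨d₁ α, rfl⟩⟩
  have ht₁ : Continuous t₁ := by
    refine Continuous.subtype_mk (Continuous.subtype_mk ?_ _) _
    rw [Units.continuous_iff]
    constructor
    · change Continuous (fun α => ((glDiagonal 3 R (d₁ α) : GL (Fin 3) R) : Matrix (Fin 3) (Fin 3) R))
      have : (fun α => ((glDiagonal 3 R (d₁ α) : GL (Fin 3) R) : Matrix (Fin 3) (Fin 3) R)) =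
          fun α => Matrix.diagonal fun k => ((d₁ α k : Rˣ) : R) := funext fun α => coe_glDiagonal 3 R (d₁ α)
      rw [this]
      refine Continuous.matrix_diagonal (continuous_pi fun k => ?_)
      fin_cases k
      · show Continuous fun α : Rˣ => ((α : Rˣ) : R)
        exact Units.continuous_val
      · show Continuous fun α : Rˣ => ((Units.map (σ : R →* R) α * α⁻¹ : Rˣ) : R)
        simp only [Units.val_mul, ← hσv]
        exact (hσc.comp Units.continuous_val).mul Units.continuous_coe_inv
      · show Continuous fun α : Rˣ => (((Units.map (σ : R →* R) α)⁻¹ : Rˣ) : R)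
        simp only [← map_inv, ← hσv]
        exact hσc.comp Units.continuous_coe_inv
    · have : (fun α => (((glDiagonal 3 R (d₁ α))⁻¹ : GL (Fin 3) R) : Matrix (Fin 3) (Fin 3) R)) =
          fun α => Matrix.diagonal fun k => (((d₁ α)⁻¹ k : Rˣ) : R) := funext fun α => by
        rw [← map_inv]; exact coe_glDiagonal 3 R (d₁ α)⁻¹
      rw [this]
      refine Continuous.matrix_diagonal (continuous_pi fun k => ?_)
      fin_cases k
      · show Continuous fun α : Rˣ => ((α⁻¹ : Rˣ) : R)
        exact Units.continuous_coe_inv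
      · show Continuous fun α : Rˣ => (((Units.map (σ : R →* R) α * α⁻¹)⁻¹ : Rˣ) : R)
        simp only [mul_inv_rev, inv_inv, Units.val_mul, ← map_inv, ← hσv]
        exact Units.continuous_val.mul (hσc.comp Units.continuous_coe_inv)
      · show Continuous fun α : Rˣ => ((((Units.map (σ : R →* R) α)⁻¹)⁻¹ : Rˣ) : R)
        simp only [inv_inv, ← hσv]
        exact hσc.comp Units.continuous_val
  have hχt₁ : ∀ α, torusCharPair σ _ rfl 0 χ₁ χ₂ (t₁ α) = χ₁ α := by
    intro α
    rw [torusCharPair_apply_of_glDiagonal_eq σ _ rfl 0 χ₁ χ₂ (t₁ α) (d₁ α) rfl]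
    have hprod : (⟨∏ j, d₁ α j, by
        rw [← torusDet_eq_of_glDiagonal_eq σ _ (t₁ α) (d₁ α) rfl]; exact torusDet_mem_normOneUnits σ _ rfl (t₁ α)⟩ :
        ↥(normOneUnits σ)) = 1 := by
      apply Subtype.ext
      show ∏ j, d₁ α j = 1
      rw [Fin.prod_univ_three]
      show α * (Units.map (σ : R →* R) α * α⁻¹) * (Units.map (σ : R →* R) α)⁻¹ = 1
      rw [mul_comm (Units.map (σ : R →* R) α) α⁻¹, ← mul_assoc, mul_inv_cancel, one_mul, mul_inv_cancel]
    rw [hprod, map_one, mul_one]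
    rfl
  -- §b the section `β ↦ d(1, β, 1)`
  let d₂ : ↥(normOneUnits σ) → Fin 3 → Rˣ := fun β => ![1, (β : Rˣ), 1]
  have hd₂ : ∀ β, glDiagonal 3 R (d₂ β) ∈ unitaryGroupOfForm σ ((StdForm.antidiagonal 3).over R) := by
    intro β
    rw [glDiagonal_mem_unitaryGroupOfForm_antidiagonal_iff]
    intro i
    fin_cases i
    · show σ ((1 : Rˣ) : R) * ((1 : Rˣ) : R) = 1
      rw [Units.val_one, map_one, mul_one]
    · show σ (((β : Rˣ) : Rˣ) : R) * (((β : Rˣ) : Rˣ) : R) = 1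
      exact (mem_normOneUnits_iff _).1 β.2
    · show σ ((1 : Rˣ) : R) * ((1 : Rˣ) : R) = 1
      rw [Units.val_one, map_one, mul_one]
  let t₂ : ↥(normOneUnits σ) → ↥(torusU σ ((StdForm.antidiagonal 3).over R)) :=
    fun β => ⟨⟨glDiagonal 3 R (d₂ β), hd₂ β⟩, ⟨d₂ β, rfl⟩⟩
  have ht₂ : Continuous t₂ := by
    refine Continuous.subtype_mk (Continuous.subtype_mk ?_ _) _
    rw [Units.continuous_iff]
    constructor
    · change Continuous (fun β => ((glDiagonal 3 R (d₂ β) : GL (Fin 3) R) : Matrix (Fin 3) (Fin 3) R))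
      have : (fun β => ((glDiagonal 3 R (d₂ β) : GL (Fin 3) R) : Matrix (Fin 3) (Fin 3) R)) =
          fun β => Matrix.diagonal fun k => ((d₂ β k : Rˣ) : R) := funext fun β => coe_glDiagonal 3 R (d₂ β)
      rw [this]
      refine Continuous.matrix_diagonal (continuous_pi fun k => ?_)
      fin_cases k
      · exact continuous_const
      · show Continuous fun β : ↥(normOneUnits σ) => (((β : Rˣ) : Rˣ) : R)
        exact Units.continuous_val.comp continuous_subtype_val
      · exact continuous_const
    · have : (fun β => (((glDiagonal 3 R (d₂ β))⁻¹ : GL (Fin 3) R) : Matrix (Fin 3) (Fin 3) R)) =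
          fun β => Matrix.diagonal fun k => (((d₂ β)⁻¹ k : Rˣ) : R) := funext fun β => by
        rw [← map_inv]; exact coe_glDiagonal 3 R (d₂ β)⁻¹
      rw [this]
      refine Continuous.matrix_diagonal (continuous_pi fun k => ?_)
      fin_cases k
      · exact continuous_const
      · show Continuous fun β : ↥(normOneUnits σ) => ((((β : Rˣ) : Rˣ)⁻¹ : Rˣ) : R)
        exact Units.continuous_coe_inv.comp continuous_subtype_val
      · exact continuous_const
  have hχt₂ : ∀ β, torusCharPair σ _ rfl 0 χ₁ χ₂ (t₂ β) = χ₂ β := by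
    intro β
    rw [torusCharPair_apply_of_glDiagonal_eq σ _ rfl 0 χ₁ χ₂ (t₂ β) (d₂ β) rfl]
    have hprod : (⟨∏ j, d₂ β j, by
        rw [← torusDet_eq_of_glDiagonal_eq σ _ (t₂ β) (d₂ β) rfl]; exact torusDet_mem_normOneUnits σ _ rfl (t₂ β)⟩ :
        ↥(normOneUnits σ)) = β := by
      apply Subtype.ext
      show ∏ j, d₂ β j = (β : Rˣ)
      rw [Fin.prod_univ_three]
      show (1 : Rˣ) * (β : Rˣ) * 1 = (β : Rˣ)
      rw [one_mul, mul_one]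
    rw [hprod]
    show χ₁ 1 * χ₂ β = χ₂ β
    rw [map_one, one_mul]
  -- §c conclude
  constructor
  · have heq : (fun x : Rˣ => ((χ₁ x : ℂˣ) : ℂ)) =
        (fun t : ↥(torusU σ ((StdForm.antidiagonal 3).over R)) => ((torusCharPair σ _ rfl 0 χ₁ χ₂ t : ℂˣ) : ℂ)) ∘ t₁ :=
      funext fun α => by rw [Function.comp_apply, hχt₁]
    rw [heq]
    exact h.comp ht₁
  · have heq : (fun x : ↥(normOneUnits σ) => ((χ₂ x : ℂˣ) : ℂ)) =
        (fun t : ↥(torusU σ ((StdForm.antidiagonal 3).over R)) => ((torusCharPair σ _ rfl 0 χ₁ χ₂ t : ℂˣ) : ℂ)) ∘ t₂ :=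
      funext fun β => by rw [Function.comp_apply, hχt₂]
    rw [heq]
    exact h.comp ht₂

omit [IsTopologicalRing R] in
/-- Continuity passes to the Weyl-conjugate first component `χ̄₁⁻¹ = (χ₁ ∘ σ)⁻¹` (continuous `σ`). [cite: Rogawski1990, §12.2 p. 173] -/
theorem continuous_coe_conjInvChar (hσc : Continuous σ) (χ₁ : Rˣ →* ℂˣ) (hχ : Continuous fun x : Rˣ => ((χ₁ x : ℂˣ) : ℂ)) :
    Continuous fun x : Rˣ => ((conjInvChar σ χ₁ x : ℂˣ) : ℂ) := by
  have h1 : Continuous (Units.map (σ : R →* R) : Rˣ → Rˣ) := Units.continuous_map hσc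
  have h2 : (fun x : Rˣ => ((conjInvChar σ χ₁ x : ℂˣ) : ℂ)) =
      fun x => (((χ₁ (Units.map (σ : R →* R) x) : ℂˣ) : ℂ))⁻¹ := by
    funext x
    rw [conjInvChar_apply, Units.val_inv_eq_inv_val]
  rw [h2]
  exact (hχ.comp h1).inv₀ fun x => Units.ne_zero _

end Torus

/-! ## §2 The principal series of a DIScontinuous character is zero -/

section Vacuity

universe u

variable {G : Type u} [Group G] [TopologicalSpace G] [IsTopologicalGroup G] (t : ParabolicTriple G) [LocallyCompactSpace t.P]

/-- `p ↦ δ_P^{1/2}(p)` is continuous (★ `continuous_modularCharacter`, square root, coercions). [folklore] -/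
theorem continuous_coe_rootDeltaChar : Continuous fun p : ↥t.P => ((rootDeltaChar t.P p : ℂˣ) : ℂ) := by
  have h : (fun p : ↥t.P => ((rootDeltaChar t.P p : ℂˣ) : ℂ)) =
      fun p => (((NNReal.sqrt (Measure.modularCharacter p) : NNReal) : ℝ) : ℂ) := funext fun p => rootDeltaChar_apply t.P p
  rw [h]
  exact Complex.continuous_ofReal.comp (NNReal.continuous_coe.comp
    (NNReal.continuous_sqrt.comp Literature.MeasureTheory.Group.continuous_modularCharacter))

/-- **A non-zero vector of `i_P^G(χ)` forces `χ` to be continuous.**  If `f ∈ i(χ)` (smooth: open stabiliser `S`) has `f(g) ≠ 0`, then for `m ∈ M`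
with `g⁻¹ m g ∈ S`: `f(g) = f(m g) = δ_P^{1/2}(m) χ(m) f(g)`, so `χ = δ_P^{-1/2}` on a neighbourhood of `1` in `M` — continuous there (★
`continuous_modularCharacter`), hence everywhere (a homomorphism continuous at `1`). [cite: BernsteinZelevinsky1976, §2.21–2.23] -/
theorem continuous_of_smoothInd_ne_zero (χ : ↥t.M →* ℂˣ)
    (f : Representation.SmoothInd t.P
      (Representation.twist (((Representation.trivial ℂ ↥t.M ℂ).twist χ).comp t.proj) (rootDeltaChar t.P)))
    (hf : f ≠ 0) : Continuous fun m : ↥t.M => ((χ m : ℂˣ) : ℂ) := by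
  -- a point where `f` does not vanish
  have hne : f.toFun ≠ 0 := fun h => hf (Representation.SmoothInd.ext (by rw [h]; rfl))
  obtain ⟨g, hg⟩ := Function.ne_iff.1 hne
  -- the open stabiliser of `f` under right translation
  set f₁ : Representation.coindV t.P.subtype
      (Representation.twist (((Representation.trivial ℂ ↥t.M ℂ).twist χ).comp t.proj) (rootDeltaChar t.P)) :=
    (show ↥(Representation.smoothInd t.P
      (Representation.twist (((Representation.trivial ℂ ↥t.M ℂ).twist χ).comp t.proj) (rootDeltaChar t.P))).toSubmodule from f).1
    with hf₁
  have hfS : IsOpen ((Representation.indFun t.P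
      (Representation.twist (((Representation.trivial ℂ ↥t.M ℂ).twist χ).comp t.proj) (rootDeltaChar t.P))).stabilizerSubgroup f₁ :
        Set G) :=
    (show ↥(Representation.smoothInd t.P
      (Representation.twist (((Representation.trivial ℂ ↥t.M ℂ).twist χ).comp t.proj) (rootDeltaChar t.P))).toSubmodule from f).2
  have hstab : ∀ s ∈ (Representation.indFun t.P
      (Representation.twist (((Representation.trivial ℂ ↥t.M ℂ).twist χ).comp t.proj) (rootDeltaChar t.P))).stabilizerSubgroup f₁,
      ∀ x : G, f.toFun (x * s) = f.toFun x := by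
    intro s hs x
    rw [Representation.mem_stabilizerSubgroup] at hs
    have h := congrArg (fun φ : Representation.coindV t.P.subtype _ => (φ : G → ℂ) x) hs
    simp only [Representation.indFun_apply_apply] at h
    exact h
  -- the neighbourhood `U = {m | g⁻¹ m g ∈ S}` of `1` in `M`, on which `δ^{1/2} χ = 1`
  have hcont : Continuous fun m : ↥t.M => g⁻¹ * (m : G) * g :=
    (continuous_const.mul continuous_subtype_val).mul continuous_const
  have hU : ∀ m : ↥t.M, g⁻¹ * (m : G) * g ∈ (Representation.indFun t.P
      (Representation.twist (((Representation.trivial ℂ ↥t.M ℂ).twist χ).comp t.proj) (rootDeltaChar t.P))).stabilizerSubgroup f₁ →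
      ((rootDeltaChar t.P (Subgroup.inclusion t.M_le m) : ℂˣ) : ℂ) * ((χ m : ℂˣ) : ℂ) = 1 := by
    intro m hm
    have h1 : f.toFun ((m : G) * g) = f.toFun g := by
      rw [show (m : G) * g = g * (g⁻¹ * (m : G) * g) by group]
      exact hstab _ hm g
    have h2 : f.toFun ((m : G) * g) = (((rootDeltaChar t.P (Subgroup.inclusion t.M_le m) : ℂˣ) : ℂ) * ((χ m : ℂˣ) : ℂ)) * f.toFun g := by
      rw [show (m : G) * g = ((Subgroup.inclusion t.M_le m : ↥t.P) : G) * g from rfl, Representation.SmoothInd.toFun_subgroup_mul,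
        F0P2pJacquetConstituentLemmas.twist_trivial_twist_comp_proj_apply, t.proj_inclusion]
    rw [h2] at h1
    exact mul_right_cancel₀ hg (h1.trans (one_mul _).symm)
  -- hence `χ = δ^{-1/2}` near `1`, a continuous function
  have hψ : Continuous fun m : ↥t.M => (((rootDeltaChar t.P (Subgroup.inclusion t.M_le m) : ℂˣ) : ℂ))⁻¹ :=
    ((continuous_coe_rootDeltaChar t).comp (continuous_inclusion t.M_le)).inv₀ fun m => Units.ne_zero _
  have hev : (fun m : ↥t.M => ((χ m : ℂˣ) : ℂ)) =ᶠ[nhds 1]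
      fun m => (((rootDeltaChar t.P (Subgroup.inclusion t.M_le m) : ℂˣ) : ℂ))⁻¹ := by
    have hmem : {m : ↥t.M | g⁻¹ * (m : G) * g ∈ (Representation.indFun t.P
        (Representation.twist (((Representation.trivial ℂ ↥t.M ℂ).twist χ).comp t.proj) (rootDeltaChar t.P))).stabilizerSubgroup f₁} ∈
        nhds (1 : ↥t.M) := by
      have h1 : g⁻¹ * ((1 : ↥t.M) : G) * g = 1 := by rw [OneMemClass.coe_one, mul_one, inv_mul_cancel]
      refine (hfS.preimage hcont).mem_nhds ?_
      simp only [Set.mem_preimage, h1, SetLike.mem_coe]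
      exact Subgroup.one_mem _
    filter_upwards [hmem] with m hm
    exact (inv_eq_of_mul_eq_one_right (hU m hm)).symm
  have h1 : ContinuousAt (fun m : ↥t.M => ((χ m : ℂˣ) : ℂ)) 1 := (hψ.continuousAt).congr hev.symm
  exact continuous_of_continuousAt_one ((Units.coeHom ℂ).comp χ) h1

/-- **`i_P^G(χ) = 0` for a DIScontinuous character `χ` of `M`.** [cite: BernsteinZelevinsky1976, §2.21–2.23] -/
theorem subsingleton_smoothInd_of_not_continuous (χ : ↥t.M →* ℂˣ) (hχ : ¬ Continuous fun m : ↥t.M => ((χ m : ℂˣ) : ℂ)) :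
    Subsingleton (Representation.SmoothInd t.P
      (Representation.twist (((Representation.trivial ℂ ↥t.M ℂ).twist χ).comp t.proj) (rootDeltaChar t.P))) := by
  by_contra h
  rw [not_subsingleton_iff_nontrivial] at h
  obtain ⟨f, hf⟩ := exists_ne (0 : Representation.SmoothInd t.P
      (Representation.twist (((Representation.trivial ℂ ↥t.M ℂ).twist χ).comp t.proj) (rootDeltaChar t.P)))
  exact hχ (continuous_of_smoothInd_ne_zero t χ f hf)

end Vacuity

end Summit.HodgeConjecture.HodgeConjecture.Cruxes.H413.F0P2pTorusPairsAndVacuity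

end
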